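import Literature.AlgebraicGeometry.ShimuraVarieties.UnitaryBallLevelFiniteCover
import Literature.AlgebraicGeometry.ShimuraVarieties.UnitaryBallHeckeTranslation
import HarnessLib

/-!
# A Hecke translation of compact ball quotients is a finite covering

Let `X₁`, `X₂` be complex projective surfaces uniformised by the complex `2`-ball (the tree's
`UnitaryBallUniformisationDatum 2 Xᵢ`: a Gram matrix `Hᵢ` of signature `(2,1)`, a torsion-free cocompact
lattice, and the uniformisation `unifᵢ` of `Xᵢ(ℂ)` by the negative cone of `Hᵢ`), and let `g ∈ GL₃(ℂ)` be an
ISOMETRY `gᴴ H₂ g = H₁`.  Any map `f : X₁(ℂ) → X₂(ℂ)` lying over `v ↦ g v` on the negative cone —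
`f (unif₁ v) = unif₂ (g v)` — is

* a local homeomorphism (`isLocalHomeomorph_of_unif_mulVec`), a covering map (`isCoveringMap_of_unif_mulVec`:
  local homeomorphism from a compact Hausdorff space onto a Hausdorff space), onto, with finite fibres, hence
* **a finite covering** in the sense of the tree's `IsFiniteCover` (`isFiniteCover_of_unif_mulVec`), so that its
  normalised transfer `τ'` with `τ' ∘ f^* = id` on `Hⁿ(X₂(ℂ); R)` is available (`IsFiniteCover.transferMap_map`).

The case of record (`isFiniteCover_of_unif_mulVec_of_mem_realPoints`): ONE hermitian space, `H₁ = H₂ = H^{τ₁}`,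
and `g = γ^{τ₁}` for a rational isometry `γ ∈ U(V)(F)` — the HECKE TRANSLATION `[v] ↦ [γ v] : X_{Γ'} → X_Γ`
(`γ Γ' γ⁻¹ ≤ Γ`) of torsion-free compact ball quotients, the second leg of a Hecke correspondence
`X_{Γ'} ⇉ X_Γ`; it is a finite covering but NOT a Galois one in general.  The level covering (`g = 1`) is the
tree's `UnitaryBallLevelFiniteCover` (`UnitaryBallQuotientDatum.isFiniteCover_of_unif_comp`).  Proof = the tree's proof for the
level covering VERBATIM with the frame `g⁻¹ T` («frame transport along `g`»,
`UnitaryBallHeckeTranslation.conjTranspose_mul_mul_of_frame`) in place of `SylvesterFrame.transport`: in the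
frames `g⁻¹T` on `X₁` and `T` on `X₂` the map `f` is `ballUnifMap₂ T ∘ (ballUnifMap₁ (g⁻¹T))⁻¹` locally
(`apply_ballUnifMap_mulVec`).

Cell pub-hodgecm2, lane «L-BYPASS» (kernel text by the seat pub-hodgecm2-s2crux-idea-2, probe `RA-v27` Part F1,
gen 8; filed by b10).  Theorems only; no definition, no named fact.

References: N. Bergeron, J. Millson, C. Moeglin, *The Hodge conjecture and arithmetic quotients of complex
balls*, Acta Math. 216 (2016), Part 2 §1.1, §1.3, §1.8 [BergeronMillsonMoeglin2016Balls]; G. Shimura,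
*Introduction to the Arithmetic Theory of Automorphic Functions* (1971), §7.2–7.3 (Hecke correspondences of
arithmetic quotients) [Shimura1971]; A. Hatcher, *Algebraic Topology* (2002), §1.3 and §3.G Prop. 3G.1
[HatcherAT2002].
-/

set_option autoImplicit false

noncomputable section

open Matrix Complex
open Literature.Geometry.ComplexHyperbolic
open Literature.Geometry.ComplexHyperbolic.BallModel
open Literature.AlgebraicTopology.SingularHomology

namespace Literature.AlgebraicGeometry.ShimuraVarieties

namespace UnitaryBallUniformisationDatum

open Literature.AlgebraicGeometry.Motives (SchemeOver ComplexPoints IsSmoothProjective)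
open Literature.AlgebraicGeometry.Motives

variable {X₁ X₂ : SchemeOver ℂ} {D₁ : UnitaryBallUniformisationDatum 2 X₁} {D₂ : UnitaryBallUniformisationDatum 2 X₂}
  {g : GL (Fin 3) ℂ}

/-- **Frame transport along the isometry `g`.**  A Sylvester frame `T` of `(ℂ³, H₂)` gives the Sylvester frame
`g⁻¹ T` of `(ℂ³, H₁)` (`UnitaryBallHeckeTranslation.conjTranspose_mul_mul_of_frame`), and `f ∘ unif₁ = unif₂ ∘ g` on
the cone gives `f ∘ ballUnifMap₁ (g⁻¹T) = ballUnifMap₂ T` (`g (g⁻¹ T) = T`).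
[cite: BergeronMillsonMoeglin2016Balls, Part 2 §1.1] -/
theorem apply_ballUnifMap_mulVec
    (hg : (g : Matrix (Fin 3) (Fin 3) ℂ)ᴴ * D₂.Hℂ * (g : Matrix (Fin 3) (Fin 3) ℂ) = D₁.Hℂ)
    (𝔣 : D₂.SylvesterFrame) {f : ComplexPoints X₁ → ComplexPoints X₂}
    (hf : ∀ v ∈ D₁.cone, f (D₁.unif v) = D₂.unif ((g : Matrix (Fin 3) (Fin 3) ℂ) *ᵥ v)) (z : Ball) :
    f (D₁.ballUnifMap
        (⟨g⁻¹ * 𝔣.T, UnitaryBallHeckeTranslation.conjTranspose_mul_mul_of_frame hg 𝔣⟩ : D₁.SylvesterFrame) z) =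
      D₂.ballUnifMap 𝔣 z := by
  have hS : (g : Matrix (Fin 3) (Fin 3) ℂ) * ((g⁻¹ * 𝔣.T : GL (Fin 3) ℂ) : Matrix (Fin 3) (Fin 3) ℂ) = 𝔣.t := by
    rw [← Units.val_mul, mul_inv_cancel_left]
  rw [ballUnifMap_apply, ballUnifMap_apply, hf _ (D₁.coneLift _ z).2]
  change D₂.unif ((g : Matrix (Fin 3) (Fin 3) ℂ) *ᵥ
    (((g⁻¹ * 𝔣.T : GL (Fin 3) ℂ) : Matrix (Fin 3) (Fin 3) ℂ) *ᵥ BallModel.lift z)) = _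
  rw [mulVec_mulVec, hS]
  rfl

/-- **A map intertwining `unif₁` with `unif₂ ∘ g`, `g` an isometry, is a local homeomorphism** (both
uniformizations are local homeomorphisms and the first is onto; in the frames `g⁻¹T`, `T` the map is
`ballUnifMap₂ T ∘ (ballUnifMap₁ (g⁻¹T))⁻¹` locally). [cite: BergeronMillsonMoeglin2016Balls, Introduction §1.1] -/
theorem isLocalHomeomorph_of_unif_mulVec
    (hg : (g : Matrix (Fin 3) (Fin 3) ℂ)ᴴ * D₂.Hℂ * (g : Matrix (Fin 3) (Fin 3) ℂ) = D₁.Hℂ)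
    {f : ComplexPoints X₁ → ComplexPoints X₂}
    (hf : ∀ v ∈ D₁.cone, f (D₁.unif v) = D₂.unif ((g : Matrix (Fin 3) (Fin 3) ℂ) *ᵥ v)) :
    IsLocalHomeomorph f := by
  obtain ⟨𝔣⟩ := D₂.nonempty_sylvesterFrame
  have hcomp : f ∘ D₁.ballUnifMap (⟨g⁻¹ * 𝔣.T, UnitaryBallHeckeTranslation.conjTranspose_mul_mul_of_frame hg 𝔣⟩ : D₁.SylvesterFrame) =
      D₂.ballUnifMap 𝔣 :=
    funext (apply_ballUnifMap_mulVec hg 𝔣 hf)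
  have h₂ : IsLocalHomeomorphOn
      (f ∘ D₁.ballUnifMap (⟨g⁻¹ * 𝔣.T, UnitaryBallHeckeTranslation.conjTranspose_mul_mul_of_frame hg 𝔣⟩ : D₁.SylvesterFrame)) Set.univ := by
    rw [hcomp]
    exact (D₂.isLocalHomeomorph_ballUnifMap 𝔣).isLocalHomeomorphOn
  have h := h₂.of_comp_right (D₁.isLocalHomeomorph_ballUnifMap _).isLocalHomeomorphOn
  rw [Set.image_univ, (D₁.ballUnifMap_surjective _).range_eq] at h
  exact isLocalHomeomorph_iff_isLocalHomeomorphOn_univ.2 h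

/-- **Such a map is a covering map** (a local homeomorphism from a compact Hausdorff space to a Hausdorff
space). [cite: BergeronMillsonMoeglin2016Balls, Part 2 §1.3 and §1.8] -/
theorem isCoveringMap_of_unif_mulVec
    (hg : (g : Matrix (Fin 3) (Fin 3) ℂ)ᴴ * D₂.Hℂ * (g : Matrix (Fin 3) (Fin 3) ℂ) = D₁.Hℂ)
    {f : ComplexPoints X₁ → ComplexPoints X₂}
    (hf : ∀ v ∈ D₁.cone, f (D₁.unif v) = D₂.unif ((g : Matrix (Fin 3) (Fin 3) ℂ) *ᵥ v)) :
    IsCoveringMap f := by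
  haveI := D₁.compactSpace_complexPoints
  haveI := D₁.t2Space_complexPoints
  haveI := D₂.t2Space_complexPoints
  exact isLocalHomeomorph_iff_isCoveringMap.1 (isLocalHomeomorph_of_unif_mulVec hg hf)

/-- Such a map is continuous. [cite: BergeronMillsonMoeglin2016Balls, Introduction §1.1] -/
theorem continuous_of_unif_mulVec
    (hg : (g : Matrix (Fin 3) (Fin 3) ℂ)ᴴ * D₂.Hℂ * (g : Matrix (Fin 3) (Fin 3) ℂ) = D₁.Hℂ)
    {f : ComplexPoints X₁ → ComplexPoints X₂}
    (hf : ∀ v ∈ D₁.cone, f (D₁.unif v) = D₂.unif ((g : Matrix (Fin 3) (Fin 3) ℂ) *ᵥ v)) :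
    Continuous f :=
  (isLocalHomeomorph_of_unif_mulVec hg hf).continuous

/-- Such a map is onto. [cite: BergeronMillsonMoeglin2016Balls, Introduction §1.1] -/
theorem surjective_of_unif_mulVec
    (hg : (g : Matrix (Fin 3) (Fin 3) ℂ)ᴴ * D₂.Hℂ * (g : Matrix (Fin 3) (Fin 3) ℂ) = D₁.Hℂ)
    {f : ComplexPoints X₁ → ComplexPoints X₂}
    (hf : ∀ v ∈ D₁.cone, f (D₁.unif v) = D₂.unif ((g : Matrix (Fin 3) (Fin 3) ℂ) *ᵥ v)) :
    Function.Surjective f := by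
  obtain ⟨𝔣⟩ := D₂.nonempty_sylvesterFrame
  intro P
  obtain ⟨z, rfl⟩ := D₂.ballUnifMap_surjective 𝔣 P
  exact ⟨_, apply_ballUnifMap_mulVec hg 𝔣 hf z⟩

/-- Such a map has finite fibres (discrete and closed in the compact space `X₁(ℂ)`).
[cite: BergeronMillsonMoeglin2016Balls, Part 2 §1.3 and §1.8] -/
theorem finite_preimage_of_unif_mulVec
    (hg : (g : Matrix (Fin 3) (Fin 3) ℂ)ᴴ * D₂.Hℂ * (g : Matrix (Fin 3) (Fin 3) ℂ) = D₁.Hℂ)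
    {f : ComplexPoints X₁ → ComplexPoints X₂}
    (hf : ∀ v ∈ D₁.cone, f (D₁.unif v) = D₂.unif ((g : Matrix (Fin 3) (Fin 3) ℂ) *ᵥ v))
    (P : ComplexPoints X₂) : (f ⁻¹' {P}).Finite := by
  haveI := D₁.compactSpace_complexPoints
  haveI := D₂.t2Space_complexPoints
  have hc := isCoveringMap_of_unif_mulVec hg hf
  haveI := (hc P).discreteTopology_fiber
  exact ((isClosed_singleton.preimage hc.continuous).isCompact).finite
    (isDiscrete_iff_discreteTopology.2 inferInstance)

/-- **A Hecke translation of torsion-free compact ball quotients is a finite covering** in the sense of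
`IsFiniteCover` (so its normalised transfer `τ^*`, `τ^* ∘ f^* = id` on `Hⁿ(X₂(ℂ); R)`, is available:
`IsFiniteCover.transferMap_map`). [cite: BergeronMillsonMoeglin2016Balls, Part 2 §1.8]
[cite: Shimura1971, §7.2–7.3] [cite: HatcherAT2002, §3.G Prop. 3G.1] -/
theorem isFiniteCover_of_unif_mulVec
    (hg : (g : Matrix (Fin 3) (Fin 3) ℂ)ᴴ * D₂.Hℂ * (g : Matrix (Fin 3) (Fin 3) ℂ) = D₁.Hℂ)
    (f : C(ComplexPoints X₁, ComplexPoints X₂))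
    (hf : ∀ v ∈ D₁.cone, f (D₁.unif v) = D₂.unif ((g : Matrix (Fin 3) (Fin 3) ℂ) *ᵥ v)) :
    IsFiniteCover f where
  isCoveringMap := isCoveringMap_of_unif_mulVec hg hf
  surjective := surjective_of_unif_mulVec hg hf
  finite_fibre := finite_preimage_of_unif_mulVec hg hf

/-- The Hecke translation has a positive number of sheets. [cite: BergeronMillsonMoeglin2016Balls, Part 2 §1.8] -/
theorem sheets_pos_of_unif_mulVec
    (hg : (g : Matrix (Fin 3) (Fin 3) ℂ)ᴴ * D₂.Hℂ * (g : Matrix (Fin 3) (Fin 3) ℂ) = D₁.Hℂ)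
    (f : C(ComplexPoints X₁, ComplexPoints X₂))
    (hf : ∀ v ∈ D₁.cone, f (D₁.unif v) = D₂.unif ((g : Matrix (Fin 3) (Fin 3) ℂ) *ᵥ v)) :
    0 < (isFiniteCover_of_unif_mulVec hg f hf).sheets :=
  haveI := D₂.nonempty_complexPoints
  (isFiniteCover_of_unif_mulVec hg f hf).sheets_pos

/-- **One hermitian space, `g ∈ U(H^{τ₁})`** (the case of record: `D₁.Hℂ = D₂.Hℂ`, `g = γ^{τ₁}` for a rational
isometry `γ ∈ U(V)(F)`): the Hecke translation `[v] ↦ [g v]` is a finite covering.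
[cite: BergeronMillsonMoeglin2016Balls, Part 2 §1.8] [cite: Shimura1971, §7.2–7.3] -/
theorem isFiniteCover_of_unif_mulVec_of_mem_realPoints (hH : D₁.Hℂ = D₂.Hℂ) (hg : g ∈ D₂.realPoints)
    (f : C(ComplexPoints X₁, ComplexPoints X₂))
    (hf : ∀ v ∈ D₁.cone, f (D₁.unif v) = D₂.unif ((g : Matrix (Fin 3) (Fin 3) ℂ) *ᵥ v)) :
    IsFiniteCover f :=
  isFiniteCover_of_unif_mulVec ((ConeChart.mem_unitaryGroup_conj_iff.mp hg).trans hH.symm) f hf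

end UnitaryBallUniformisationDatum

end Literature.AlgebraicGeometry.ShimuraVarieties

end
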